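import Literature.NumberTheory.Rogawski1990.GlobalAPacketMembership
import Literature.NumberTheory.Automorphic.Zelevinsky1980.InducedCharacterRigidity
import Literature.NumberTheory.Automorphic.Liu2021.LemD1LocalInjectivity
import Summits.HodgeConjecture.HodgeConjecture.Theorems.F0P3FinRepConstituentsExist
import HarnessLib

/-!
# U♭-loc at the split places: two ξ-local families containing the finite local constituents of ONE discrete `P`
# have the same split labels `η̃_w, ψ̃_w` at every common witness `w ∣ v`

Cell `hodgecm-mathlib`, F0∕P3 «U3-mult», crux H413 (`stmt-HodgeConjecture-24833`); F0P3-plan (g3) RULING (U5) (2026-08-31), desk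
(G-U♭loc) of F0P3-p03 (g6); `PLAN.F0P3g3.md` §19∕§19c.  Helper file: THEOREMS ONLY (no definition, no named fact, no instance, no
`sorry`); `--supports stmt-HodgeConjecture-24833 --as helper`.

THE POINT.  Rung 4 of row III-J3a asks the engine for Rogawski's classification (E1, S2♭, R♭ over ★ D6 `MemXiFamily`).  The
family-rigidity lemma U♭ «`MemXiFamily P … ξ → MemXiFamily P … ξ′ → ξ = ξ′`» of PLAN §19 was booked as needing a
Bernstein–Zelevinsky letter (BZ77 Thm. 2.9: an irreducible `Ind_{Q_{2,1}}^{GL₃}((ν₀ ∘ det) ⊠ χ′)` determines `(ν₀, χ′)`).  That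
letter IS a tree theorem, in exactly the currency of ★ `Rogawski1990.splitMemberGL`:
★ `Zelevinsky1980.eq_of_areIsomorphicRep_parabolicIndGL_detChar` (`Zelevinsky1980/InducedCharacterRigidity`).  This file runs the
LOCAL half of U♭ at the SPLIT places on it:

* §1 `splitLabels_eq_of_mem_cmSplitPacket_members` — PACKET CORE: if one class `c ∈ Irr(U(H)(L⁺_v))` lies in the split packets
  ★ `cmSplitPacket … v w hw ν₀ χ′ …` and `cmSplitPacket … v w hw ν₀′ χ″ …` (same `w ∣ v`, unitary continuous labels) then
  `ν₀ = ν₀′ ∧ χ′ = χ″` (singleton packets ★ `mem_cmSplitPacket_members_iff`; `IrrClass.comap` along ★ `cmSplitEquiv` is injective;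
  equal classes are isomorphic representations ★ `IrrClass.mk_eq_mk_iff` ∕ ★ `Liu2021.areIsomorphicRep_iff_nonempty_equiv`; then BZ).
* §2 `locη_eq_and_locψ_eq_of_mem_cmSplitPacket_members`, `bc_localComponent_eq_of_mem_cmSplitPacket_members` — for the labels
  `ν₀ = η_w ψ_w μ_w = ξ.splitν₀ μω w`, `χ′ = ψ_w = ξ.locψ w` of two one-dimensional automorphic `ξ, ξ′ : OneDimAutRepH L` (★ D5) and
  ONE auxiliary `μω`: `η_w = η′_w`, `ψ_w = ψ′_w`, i.e. `ξ.bcη`, `ξ′.bcη` (resp. `bcψ`) have the same local component at `w`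
  (★ `HeckeCharacter.localComponent`; cancel the unit `μω.localComponent w`).
* §3 `bc_localComponent_eq_of_localConstituentsIn` — FAMILY LEVEL, COMMON CHOICE: for a discrete automorphic `P` of `U(H)` with
  an irreducible smooth finite component `σ` (so that `P` HAS a local constituent at `v`, ★ `F0P3FinRepConstituentsExist`), two
  families `Pv, Pv′` of CM local packets containing the finite local constituents of `P` (★ `LocalConstituentsIn`) which at a
  split `v` are the split packets of `ξ`, `ξ′` read at the SAME `w ∣ v` (the split clause of ★ `OneDimAutRepH.IsXiLocalFamily`, D6's
  tokens verbatim) force `ξ.bcη`, `ξ′.bcη` and `ξ.bcψ`, `ξ′.bcψ` to agree at `w`; `…_of_memXiFamily_witnesses` repackages this for two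
  `MemXiFamily` witnesses.  What is NOT here (recorded residue, PLAN §19c): the `w ↔ w̄` rider (two families may read `v` through
  conjugate places) and the GLOBAL half (torus characters agreeing at every split place are equal — F0P3-p01 (g6) (U1)).

EDITION 2 (over D6 ED. 2 — DEFINITE split witness ★ `Rogawski1990.splitWitness v hs`, director s496 (D-a), F0P3-plan (g3) RULING (U10),
typed by F0-typ3 (g5)): §4 adds the RIDER-FREE U♭-loc `bc_localComponent_eq_of_memXiFamily` — two `MemXiFamily` memberships of ONE `P`
force equal labels `η̃_w, ψ̃_w` of `ξ`, `ξ′` at `w = splitWitness v hs` for EVERY split `v` (both families read `v` through the same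
definite place) — and its `∃ w`-packaging `exists_bc_localComponent_eq_of_memXiFamily` in the hypothesis shape of F0P3-p01 (g6)'s torus
rigidity `OneDimAutRepH.ext_of_split` (U6); the ed. 1.1 edition-robust proof of `exists_eq_cmSplitPacket_of_isXiLocalFamily` returns
to one branch (statement unchanged).

References: [Rogawski1990] §4.13 p. 62, Lemma 4.13.1 (b); §13.3 p. 201; §14.6 p. 246.  [Zelevinsky1980] Thm. 4.2, Thm. 6.1.
[BernsteinZelevinsky1977] Thm. 2.9.  HC_CM is proved only modulo the printed citations until rung 0 closes.
-/

set_option autoImplicit false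
set_option linter.dupNamespace false

noncomputable section

open NumberField IsDedekindDomain MeasureTheory
open scoped Matrix

namespace Summit.HodgeConjecture.HodgeConjecture.Cruxes.H413.F0P3XiLocalLabelsOfMemXiFamily

open Literature.NumberTheory.Automorphic Literature.NumberTheory.Automorphic.UnitaryGroup
open Literature.NumberTheory.GaloisRepresentations
open Literature.NumberTheory.Rogawski1990

variable {L : Type} [Field L] [NumberField L] [IsCMField L] {H : Matrix (Fin 3) (Fin 3) L}
  (hH : (H.map (cmConjRingHom L))ᵀ = H) (hHd : IsUnit H.det)
  {v : HeightOneSpectrum (𝓞 ↥(maximalRealSubfield L))}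

/-! ## §1 Packet core: one class in two split packets at the same `w` forces equal labels -/

/-- **PACKET CORE.**  At a finite place `v` of `L⁺` split in `L`, read through `w ∣ v` (`w̄ ≠ w`): if ONE class
`c ∈ Irr(U(H)(L⁺_v))` is a member of the split packets `{i_G((ν₀ ∘ det) ⊠ χ′) ∘ cmSplitEquiv}` and `{i_G((ν₀′ ∘ det) ⊠ χ″) ∘ cmSplitEquiv}`
(unitary continuous labels), then `ν₀ = ν₀′` and `χ′ = χ″` — the two induced representations of `GL₃(L_w)` are isomorphic, and an
irreducible unitary `(ν₀ ∘ det) × χ′` determines its inducing datum. [cite: Zelevinsky1980, Thm. 4.2 and Thm. 6.1]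
[cite: BernsteinZelevinsky1977, Thm. 2.9] [cite: Rogawski1990, §13.3 p. 201] -/
theorem splitLabels_eq_of_mem_cmSplitPacket_members (w : PlacesOver L v) (hw : IsCMField.complexConj L • w.1 ≠ w.1)
    {ν₀ χ' ν₀' χ'' : (w.1.adicCompletion L)ˣ →* ℂˣ} (hν₀u : ∀ x, ‖((ν₀ x : ℂˣ) : ℂ)‖ = 1)
    (hν₀c : Continuous fun x => ((ν₀ x : ℂˣ) : ℂ)) (hχ'u : ∀ x, ‖((χ' x : ℂˣ) : ℂ)‖ = 1)
    (hχ'c : Continuous fun x => ((χ' x : ℂˣ) : ℂ)) (hν₀'u : ∀ x, ‖((ν₀' x : ℂˣ) : ℂ)‖ = 1)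
    (hν₀'c : Continuous fun x => ((ν₀' x : ℂˣ) : ℂ)) (hχ''u : ∀ x, ‖((χ'' x : ℂˣ) : ℂ)‖ = 1)
    (hχ''c : Continuous fun x => ((χ'' x : ℂˣ) : ℂ)) {c : IrrClass ((cmDatum L 3 H).Local v)}
    (hc : c ∈ (cmSplitPacket L H hH hHd v w hw ν₀ χ' hν₀u hν₀c hχ'u hχ'c).members)
    (hc' : c ∈ (cmSplitPacket L H hH hHd v w hw ν₀' χ'' hν₀'u hν₀'c hχ''u hχ''c).members) :
    ν₀ = ν₀' ∧ χ' = χ'' := by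
  rw [mem_cmSplitPacket_members_iff] at hc hc'
  have h := hc.symm.trans hc'
  rw [← IrrClass.comap_mk, ← IrrClass.comap_mk] at h
  have h2 := (IrrClass.mk_eq_mk_iff _ _).1 (IrrClass.comap_injective _ h)
  exact Zelevinsky1980.eq_of_areIsomorphicRep_parabolicIndGL_detChar (w.1.adicCompletion L) ν₀ χ' ν₀' χ'' le_rfl
    hν₀u hν₀c hχ'c hχ''u (Liu2021.areIsomorphicRep_iff_nonempty_equiv.2 h2)

/-! ## §2 The labels of two one-dimensional automorphic `ξ, ξ′` at a common split witness -/

/-- **LABELS `η_w, ψ_w`.**  If one class lies in the split packets of `ξ` and of `ξ′` at the SAME `w ∣ v` — labels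
`ν₀ = η_w ψ_w μ_w = ξ.splitν₀ μω w`, `χ′ = ψ_w = ξ.locψ w` (★ D6 §1) for ONE auxiliary `μω` — then `η_w = η′_w` and `ψ_w = ψ′_w`
(cancel the common factor `μ_w`). [cite: Rogawski1990, §4.13 Lemma 4.13.1 (b); §13.3 p. 201] [cite: Zelevinsky1980, Thm. 4.2 and Thm. 6.1] -/
theorem locη_eq_and_locψ_eq_of_mem_cmSplitPacket_members (w : PlacesOver L v) (hw : IsCMField.complexConj L • w.1 ≠ w.1)
    (ξ ξ' : OneDimAutRepH L) (μω : HeckeCharacter L) (hμu : μω.IsUnitary) {c : IrrClass ((cmDatum L 3 H).Local v)}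
    (hc : c ∈ (cmSplitPacket L H hH hHd v w hw (ξ.splitν₀ μω w.1) (ξ.locψ w.1) (ξ.norm_splitν₀_apply hμu w.1)
      (ξ.continuous_splitν₀ μω w.1) (ξ.norm_locψ_apply w.1) (ξ.continuous_locψ w.1)).members)
    (hc' : c ∈ (cmSplitPacket L H hH hHd v w hw (ξ'.splitν₀ μω w.1) (ξ'.locψ w.1) (ξ'.norm_splitν₀_apply hμu w.1)
      (ξ'.continuous_splitν₀ μω w.1) (ξ'.norm_locψ_apply w.1) (ξ'.continuous_locψ w.1)).members) :
    ξ.locη w.1 = ξ'.locη w.1 ∧ ξ.locψ w.1 = ξ'.locψ w.1 := by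
  obtain ⟨hν, hψ⟩ := splitLabels_eq_of_mem_cmSplitPacket_members hH hHd w hw _ _ _ _ _ _ _ _ hc hc'
  refine ⟨?_, hψ⟩
  have h : ξ.locη w.1 * ξ.locψ w.1 * μω.localComponent w.1 = ξ'.locη w.1 * ξ'.locψ w.1 * μω.localComponent w.1 := hν
  rw [hψ] at h
  exact mul_right_cancel (mul_right_cancel h)

/-- **LOCAL COMPONENTS OF THE BASE CHANGES `η̃, ψ̃`.**  Same hypotheses: the Hecke characters `ξ.bcη = η ∘ (z ↦ z̄/z)` and
`ξ′.bcη` (resp. `ξ.bcψ`, `ξ′.bcψ`) of `L` have the SAME local component at `w` (★ `HeckeCharacter.localComponent`;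
`ξ.locη w = (ξ.bcη.localComponent w)⁻¹` is ★ D6's reading of `η_w` through the `w`-projection).
[cite: Rogawski1990, §4.13 p. 62 and Lemma 4.13.1 (b); §12.1 p. 172] [cite: Zelevinsky1980, Thm. 4.2 and Thm. 6.1] -/
theorem bc_localComponent_eq_of_mem_cmSplitPacket_members (w : PlacesOver L v) (hw : IsCMField.complexConj L • w.1 ≠ w.1)
    (ξ ξ' : OneDimAutRepH L) (μω : HeckeCharacter L) (hμu : μω.IsUnitary) {c : IrrClass ((cmDatum L 3 H).Local v)}
    (hc : c ∈ (cmSplitPacket L H hH hHd v w hw (ξ.splitν₀ μω w.1) (ξ.locψ w.1) (ξ.norm_splitν₀_apply hμu w.1)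
      (ξ.continuous_splitν₀ μω w.1) (ξ.norm_locψ_apply w.1) (ξ.continuous_locψ w.1)).members)
    (hc' : c ∈ (cmSplitPacket L H hH hHd v w hw (ξ'.splitν₀ μω w.1) (ξ'.locψ w.1) (ξ'.norm_splitν₀_apply hμu w.1)
      (ξ'.continuous_splitν₀ μω w.1) (ξ'.norm_locψ_apply w.1) (ξ'.continuous_locψ w.1)).members) :
    ξ.bcη.localComponent w.1 = ξ'.bcη.localComponent w.1 ∧ ξ.bcψ.localComponent w.1 = ξ'.bcψ.localComponent w.1 := by
  obtain ⟨hη, hψ⟩ := locη_eq_and_locψ_eq_of_mem_cmSplitPacket_members hH hHd w hw ξ ξ' μω hμu hc hc'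
  exact ⟨inv_injective hη, inv_injective hψ⟩

/-! ## §3 Family level, common choice: two families containing the local constituents of one `P` -/

section Family

variable {μ : Measure (adelicGroupData (↥(maximalRealSubfield L)) L (IsCMField.complexConj L) 3 H).automorphicQuotient}
  [(adelicGroupData (↥(maximalRealSubfield L)) L (IsCMField.complexConj L) 3 H).IsAutomorphicMeasure μ]

/-- **FAMILY LEVEL, COMMON CHOICE.**  Let `P` be a discrete automorphic representation of `U(H)(𝔸_{L⁺})` with an irreducible
smooth finite component `σ` (so that `P|_{U(H)(L⁺_v)}` HAS an irreducible constituent in the smooth-part currency, ★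
`F0P3FinRepConstituentsExist.exists_comap_isConstituentOf_finRepSmooth_comp_cm`), and let `Pv, Pv′` be two families of CM local
packets each containing every finite local constituent of `P` (★ `LocalConstituentsIn`).  If at a split `v` both families are
the split packets of `ξ`, resp. `ξ′`, read at the SAME place `w ∣ v` (the split clause of ★ `OneDimAutRepH.IsXiLocalFamily`, D6's
tokens verbatim), then `ξ.bcη`, `ξ′.bcη` and `ξ.bcψ`, `ξ′.bcψ` have the same local components at `w`: the constituent of `P_v` is
`i_G(ξ_v ⊗ μ_w ∘ det₀) = i_G(ξ′_v ⊗ μ_w ∘ det₀)`, which determines its inducing datum.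
[cite: Rogawski1990, §13.3 p. 201; §14.6 Thm. 14.6.4 (p. 246); §4.13 Lemma 4.13.1 (b)] [cite: Zelevinsky1980, Thm. 4.2 and Thm. 6.1]
[cite: BernsteinZelevinsky1977, Thm. 2.9] -/
theorem bc_localComponent_eq_of_localConstituentsIn
    (P : DiscreteAutomorphicRep (adelicGroupData (↥(maximalRealSubfield L)) L (IsCMField.complexConj L) 3 H) μ)
    {W : Type} [AddCommGroup W] [Module ℂ W]
    {σ : Representation ℂ (finAdelic (↥(maximalRealSubfield L)) L (IsCMField.complexConj L) 3 H) W}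
    (hirr : σ.IsIrreducible) (hsm : σ.IsSmooth) (hP : P.HasFinComponent σ)
    {Pv Pv' : ∀ v : HeightOneSpectrum (𝓞 ↥(maximalRealSubfield L)), CMLocalAPacket L H v}
    (hPv : LocalConstituentsIn P Pv) (hPv' : LocalConstituentsIn P Pv')
    (ξ ξ' : OneDimAutRepH L) (μω : HeckeCharacter L) (hμu : μω.IsUnitary)
    (v : HeightOneSpectrum (𝓞 ↥(maximalRealSubfield L))) (w : PlacesOver L v) (hw : IsCMField.complexConj L • w.1 ≠ w.1)
    (hv : Pv v = cmSplitPacket L H hH hHd v w hw (ξ.splitν₀ μω w.1) (ξ.locψ w.1) (ξ.norm_splitν₀_apply hμu w.1)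
      (ξ.continuous_splitν₀ μω w.1) (ξ.norm_locψ_apply w.1) (ξ.continuous_locψ w.1))
    (hv' : Pv' v = cmSplitPacket L H hH hHd v w hw (ξ'.splitν₀ μω w.1) (ξ'.locψ w.1) (ξ'.norm_splitν₀_apply hμu w.1)
      (ξ'.continuous_splitν₀ μω w.1) (ξ'.norm_locψ_apply w.1) (ξ'.continuous_locψ w.1)) :
    ξ.bcη.localComponent w.1 = ξ'.bcη.localComponent w.1 ∧ ξ.bcψ.localComponent w.1 = ξ'.bcψ.localComponent w.1 := by
  obtain ⟨c, hc⟩ := F0P3FinRepConstituentsExist.exists_comap_isConstituentOf_finRepSmooth_comp_cm P hirr hsm hP v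
  have h₁ := hPv v c hc
  have h₂ := hPv' v c hc
  rw [hv] at h₁
  rw [hv'] at h₂
  exact bc_localComponent_eq_of_mem_cmSplitPacket_members hH hHd w hw ξ ξ' μω hμu h₁ h₂

/-- **TWO `MemXiFamily` WITNESSES, COMMON CHOICE** (the corollary in D6's outer currency): if `Pv`, `Pv′` are ξ-, resp.
ξ′-local families (★ `OneDimAutRepH.IsXiLocalFamily … μω hμu`) containing the finite local constituents of one `P` (with an
irreducible smooth finite component), then at every split `v` at which the two families' split witnesses can be taken to be the
SAME `w ∣ v`, the labels `η̃_w, ψ̃_w` of `ξ` and `ξ′` agree.  Stated with the two witness equations as hypotheses (`hv`, `hv′`):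
these are exactly what the split clause of `IsXiLocalFamily` provides, up to the choice of `w` among `{w, w̄}` — the `w ↔ w̄`
rider is not treated here. [cite: Rogawski1990, §13.3 p. 201; §14.6 p. 246; §4.13 p. 62] [cite: Zelevinsky1980, Thm. 4.2 and Thm. 6.1] -/
theorem bc_localComponent_eq_of_memXiFamily_witnesses
    (P : DiscreteAutomorphicRep (adelicGroupData (↥(maximalRealSubfield L)) L (IsCMField.complexConj L) 3 H) μ)
    {W : Type} [AddCommGroup W] [Module ℂ W]
    {σ : Representation ℂ (finAdelic (↥(maximalRealSubfield L)) L (IsCMField.complexConj L) 3 H) W}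
    (hirr : σ.IsIrreducible) (hsm : σ.IsSmooth) (hP : P.HasFinComponent σ)
    (ξ ξ' : OneDimAutRepH L) (μω : HeckeCharacter L) (hμu : μω.IsUnitary)
    {Pv Pv' : ∀ v : HeightOneSpectrum (𝓞 ↥(maximalRealSubfield L)), CMLocalAPacket L H v}
    (hfam : ξ.IsXiLocalFamily hH hHd μω hμu Pv ∧ LocalConstituentsIn P Pv)
    (hfam' : ξ'.IsXiLocalFamily hH hHd μω hμu Pv' ∧ LocalConstituentsIn P Pv')
    (v : HeightOneSpectrum (𝓞 ↥(maximalRealSubfield L))) (w : PlacesOver L v) (hw : IsCMField.complexConj L • w.1 ≠ w.1)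
    (hv : Pv v = cmSplitPacket L H hH hHd v w hw (ξ.splitν₀ μω w.1) (ξ.locψ w.1) (ξ.norm_splitν₀_apply hμu w.1)
      (ξ.continuous_splitν₀ μω w.1) (ξ.norm_locψ_apply w.1) (ξ.continuous_locψ w.1))
    (hv' : Pv' v = cmSplitPacket L H hH hHd v w hw (ξ'.splitν₀ μω w.1) (ξ'.locψ w.1) (ξ'.norm_splitν₀_apply hμu w.1)
      (ξ'.continuous_splitν₀ μω w.1) (ξ'.norm_locψ_apply w.1) (ξ'.continuous_locψ w.1)) :
    ξ.bcη.localComponent w.1 = ξ'.bcη.localComponent w.1 ∧ ξ.bcψ.localComponent w.1 = ξ'.bcψ.localComponent w.1 :=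
  bc_localComponent_eq_of_localConstituentsIn hH hHd P hirr hsm hP hfam.2 hfam'.2 ξ ξ' μω hμu v w hw hv hv'

/-- **SPLIT WITNESSES EXIST** (bookkeeping for consumers): a ξ-local family IS, at every split `v`, the split packet of `ξ`
at SOME `w ∣ v` with `w̄ ≠ w` — since D6 ed. 2 the definite `splitWitness v hs` (★ `OneDimAutRepH.IsXiLocalFamily.eq_cmSplitPacket`);
kept in its ed. 1 statement for consumers that only want existence (ed. 1.1's two-branch edition-robust proof is retired).
[cite: Rogawski1990, §13.3 p. 201] -/
theorem exists_eq_cmSplitPacket_of_isXiLocalFamily (ξ : OneDimAutRepH L) (μω : HeckeCharacter L) (hμu : μω.IsUnitary)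
    {Pv : ∀ v : HeightOneSpectrum (𝓞 ↥(maximalRealSubfield L)), CMLocalAPacket L H v}
    (hPv : ξ.IsXiLocalFamily hH hHd μω hμu Pv) (v : HeightOneSpectrum (𝓞 ↥(maximalRealSubfield L)))
    (hsplit : ∃ w : PlacesOver L v, IsCMField.complexConj L • w.1 ≠ w.1) :
    ∃ (w : PlacesOver L v) (hw : IsCMField.complexConj L • w.1 ≠ w.1),
      Pv v = cmSplitPacket L H hH hHd v w hw (ξ.splitν₀ μω w.1) (ξ.locψ w.1) (ξ.norm_splitν₀_apply hμu w.1)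
        (ξ.continuous_splitν₀ μω w.1) (ξ.norm_locψ_apply w.1) (ξ.continuous_locψ w.1) :=
  ⟨_, _, hPv.1 v hsplit⟩

/-! ## §4 (ed. 2) U♭-loc at EVERY split place through D6's definite witness — no `w ↔ w̄` rider -/

/-- **U♭-loc AT EVERY SPLIT PLACE, NO RIDER (ed. 2).**  For a discrete automorphic `P` of `U(H)` with an irreducible smooth finite
component `σ` and two one-dimensional automorphic `ξ, ξ′` with `MemXiFamily P … μω hμu ξ` and `MemXiFamily P … μω hμu ξ′` (ONE `μω`): at
every finite `v` split in `L`, the Hecke characters `ξ.bcη, ξ′.bcη` (resp. `bcψ`) have the same local component at the definite place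
`w = splitWitness v hs ∣ v` of ★ D6 ed. 2 — both families read `v` through that place (★ `OneDimAutRepH.IsXiLocalFamily.eq_cmSplitPacket`),
the constituent of `P_v` lies in both singleton split packets, and an irreducible unitary `(ν₀ ∘ det) × χ′` determines `(ν₀, χ′)`
(★ `Zelevinsky1980.eq_of_areIsomorphicRep_parabolicIndGL_detChar`, via §3).
[cite: Rogawski1990, §4.13 p. 62 and Lemma 4.13.1 (b); §13.3 p. 201; §14.6 Thm. 14.6.4 (p. 246)] [cite: Zelevinsky1980, Thm. 4.2 and Thm. 6.1]
[cite: BernsteinZelevinsky1977, Thm. 2.9] -/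
theorem bc_localComponent_eq_of_memXiFamily
    (P : DiscreteAutomorphicRep (adelicGroupData (↥(maximalRealSubfield L)) L (IsCMField.complexConj L) 3 H) μ)
    {W : Type} [AddCommGroup W] [Module ℂ W]
    {σ : Representation ℂ (finAdelic (↥(maximalRealSubfield L)) L (IsCMField.complexConj L) 3 H) W}
    (hirr : σ.IsIrreducible) (hsm : σ.IsSmooth) (hP : P.HasFinComponent σ)
    (ξ ξ' : OneDimAutRepH L) (μω : HeckeCharacter L) (hμu : μω.IsUnitary)
    (h : MemXiFamily P hH hHd μω hμu ξ) (h' : MemXiFamily P hH hHd μω hμu ξ')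
    (v : HeightOneSpectrum (𝓞 ↥(maximalRealSubfield L))) (hs : ∃ w : PlacesOver L v, IsCMField.complexConj L • w.1 ≠ w.1) :
    ξ.bcη.localComponent (splitWitness v hs).1 = ξ'.bcη.localComponent (splitWitness v hs).1 ∧
      ξ.bcψ.localComponent (splitWitness v hs).1 = ξ'.bcψ.localComponent (splitWitness v hs).1 := by
  obtain ⟨Pv, hPv, hc⟩ := h
  obtain ⟨Pv', hPv', hc'⟩ := h'
  exact bc_localComponent_eq_of_localConstituentsIn hH hHd P hirr hsm hP hc hc' ξ ξ' μω hμu v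
    (splitWitness v hs) (splitWitness_spec v hs) (hPv.eq_cmSplitPacket v hs) (hPv'.eq_cmSplitPacket v hs)

/-- **U♭-loc in the `∃ w`-shape** consumed by F0P3-p01 (g6)'s torus rigidity `OneDimAutRepH.ext_of_split` (F0P3-plan (g3) (U6)): two
`MemXiFamily` memberships of one `P` (with an irreducible smooth finite component) give, for every split `v`, a place `w ∣ v`, `w̄ ≠ w`, at
which the labels `η̃_w, ψ̃_w` of `ξ` and `ξ′` agree. [cite: Rogawski1990, §4.13 p. 62; §13.3 p. 201] [cite: Zelevinsky1980, Thm. 4.2 and Thm. 6.1] -/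
theorem exists_bc_localComponent_eq_of_memXiFamily
    (P : DiscreteAutomorphicRep (adelicGroupData (↥(maximalRealSubfield L)) L (IsCMField.complexConj L) 3 H) μ)
    {W : Type} [AddCommGroup W] [Module ℂ W]
    {σ : Representation ℂ (finAdelic (↥(maximalRealSubfield L)) L (IsCMField.complexConj L) 3 H) W}
    (hirr : σ.IsIrreducible) (hsm : σ.IsSmooth) (hP : P.HasFinComponent σ)
    (ξ ξ' : OneDimAutRepH L) (μω : HeckeCharacter L) (hμu : μω.IsUnitary)
    (h : MemXiFamily P hH hHd μω hμu ξ) (h' : MemXiFamily P hH hHd μω hμu ξ') :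
    ∀ v : HeightOneSpectrum (𝓞 ↥(maximalRealSubfield L)), (∃ w : PlacesOver L v, IsCMField.complexConj L • w.1 ≠ w.1) →
      ∃ w : PlacesOver L v, IsCMField.complexConj L • w.1 ≠ w.1 ∧
        ξ.bcη.localComponent w.1 = ξ'.bcη.localComponent w.1 ∧ ξ.bcψ.localComponent w.1 = ξ'.bcψ.localComponent w.1 :=
  fun v hs => ⟨splitWitness v hs, splitWitness_spec v hs,
    bc_localComponent_eq_of_memXiFamily hH hHd P hirr hsm hP ξ ξ' μω hμu h h' v hs⟩

end Family

end Summit.HodgeConjecture.HodgeConjecture.Cruxes.H413.F0P3XiLocalLabelsOfMemXiFamily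

end
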